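import Summits.CriticalPhenomena.PercolationContinuityZ3.Theorems.PercNearOneGluingNoHeavyQuantCrossingCubeBridge
import Literature.Probability.Percolation.OneArmOSSSDiffIneqZd
import HarnessLib

/-!
# RSW3 lane (lead, gen 19): OSSS FOR CROSSINGS, I — the decision-tree variance inequality for a SET-TO-SET crossing with an
# intermediate seed set, and the annulus instance: `(N−n)·u(1−u) ≤ 4p(1−p)·S_{N−n}(p)·E_p[N_piv(Λ(n) ↔ ∂ⁱⁿΛ(N))]`

builds on p205010 (kernel theorem, internal audit signed; external expert review pending) — NOT used in this file (every `p`, every `d`).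

Cell `prim-rsw3` (LANE 3), lead seat, gen 19.  Support file (`--supports stmt-CriticalPhenomena-4575`); no definitions, no named facts,
no sorries.  Gen 18 bounded the expected number of pivotal edges of a crossing from below by Talagrand–Russo, which needs the band
condition `e^{−Λ/4} ≤ P(1−P)`; the O'Donnell–Saks–Schramm–Servedio inequality needs none.  The Literature library has the OSSS
covariance inequality for legal query strategies (`Strategy.osss_cov_strategy`) and Duminil-Copin–Raoufi–Tassion's seed exploration
(`SeedExploration.lean`, with halting correctness for a POINT source, `label_eq_of_halt`); the QUANT lane (p4) read the annulus crossing
`boxCrossing d n N = {Λ(n) ↔ ∂ⁱⁿΛ(N) in Λ(N)}` on the box cube of `Λ(N)` (`CrossingRevealment.sum_wt_gcross_eq`, `bias_mul_pivCross_eq`).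

* §1 `variance_le_sum_revealment_mul_pivCross` — ABSTRACT (finite edge-labelled graph, product measure, biases in `[0,1]`): if every
  open path from the source SET `X` to the target set `B` passes through the seed set `Z` (a seed vertex joined to both ends), then with
  `A = P(X ↔ B)`: `A − A² ≤ Σ_e R(e)·p_e(1−p_e)·P(e pivotal for {X ↔ B})` for any majorant `R(e) ≥ P(a ↔ Z) + P(b ↔ Z)` of the
  revealment of `e = ab` under the exploration of the clusters of `Z` (the set-source form of DRT's Lemma 3.2 for `q = 1`).
* §2 `sphere_separates_spheres` — for `n ≤ k ≤ N` the sphere `∂Λ_k` separates `∂Λ_n` from `∂Λ_N` in that sense (discrete intermediate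
  values of `‖·‖_∞`); `sum_Icc_dist_le_shift` — `Σ_{k=n+1}^{N} θ_{|k−s|} ≤ 2 S_{N−n}` for antitone `θ ≥ 0` and every `s`;
  `annulusCrossing_variance_le_sphere` (one sphere), **`annulusCrossing_variance_le`**:
  `(N − n)·u(1−u) ≤ 4·S_{N−n}(p)·p(1−p)·Σ_{z ⊆ Λ(N)} P_p(z ∈ E(ℤ^d), z pivotal for boxCrossing d n N)`, `u = P_p(boxCrossing d n N)`,
  `S_m(p) = Σ_{j<m} π_p(j)`, every `d ≥ 1`, `n ≤ N`, `p ∈ [0,1]`.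
* §3 **`exists_hasDerivAt_real_boxCrossing_ge_osss`** — with Russo: `p ↦ u_p(n,N)` has derivative `D = E_p[N_piv] ≥ 0` at `p ∈ (0,1)` and
  **`(N − n)·u(1−u) ≤ 4p(1−p)·S_{N−n}(p)·D`**; since `4p(1−p) ≤ 1`: `(N−n)·u(1−u) ≤ S_{N−n}(p)·D` (`…_ge_osss'`).  At aspect 2 (`N = 2n`)
  the pivotal count of the annulus is at least `n·u(1−u)/S_n(p)`: a POWER of `n` wherever `π_p(j) ≤ j^{−η}`, against gen 18's `|log 2π|`.

References: R. O'Donnell, M. Saks, O. Schramm, R. Servedio, FOCS 2005, Thm 1.1 / 3.1; H. Duminil-Copin, A. Raoufi, V. Tassion, Ann. of Math.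
189 (2019) §3 Lemma 3.2, (3.2)–(3.4); H. Duminil-Copin, arXiv:1810.03384 Lemma 3.8; V. Dewan, S. Muirhead, PTRF (2022) Lemma 2.9 (hyperplane /
sphere explorations for crossing events); L. Russo, Z. Wahrsch. verw. Gebiete 56 (1981) §4 Lemma 3.
-/

noncomputable section

namespace Summit.CriticalPhenomena.PercolationContinuityZ3.Theorems.Crossing

open MeasureTheory Finset Function
open Literature.Probability.Percolation Literature.Probability.LatticeModels
open Literature.Probability.ODonnellSaksSchrammServedio2005
open Literature.Probability.ODonnellSaksSchrammServedio2005.Strategy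
open Literature.Probability.Percolation.GhostExploration Literature.Probability.Percolation.SeedExploration
open Literature.Probability.Percolation.OneArmOSSS Literature.Probability.Percolation.DCT16
open Summit.CriticalPhenomena.PercolationContinuityZ3.Theorems.SurfaceTension
open Summit.CriticalPhenomena.PercolationContinuityZ3.Theorems.CrossingRevealment

/-! ## §1 The OSSS variance inequality for a set-to-set crossing with an intermediate seed set -/

section Abstract

variable {W E : Type*} {edge : W → W → Option E}

/-- `|2·𝟙{X ↔ B} − 1| ≤ 1`. [cite: DuminilCopinRaoufiTassion2019, §3 Lemma 3.2 (Boolean functions f : {0,1}^E → [−1,1])] -/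
theorem abs_two_mul_gcross_sub_one_le (X B : Set W) (y : E → Bool) : |2 * gcross edge X B y - 1| ≤ 1 := by
  rcases gcross_mem edge X B y with h | h <;> rw [h] <;> norm_num

variable [DecidableEq E] [Fintype E]

/-- Influence of an edge on `2·𝟙{X ↔ B} − 1`: `Inf_e = 4 p_e(1−p_e)·P(e pivotal for {X ↔ B})`.
[cite: OdonnellEtAl2005, §3.1 p. 6 (Inf^{ρ₁} for Boolean-valued coordinates)] -/
theorem infl_two_mul_gcross_sub_one (p : E → ℝ) (X B : Set W) (e : E) :
    infl p e (fun y => 2 * gcross edge X B y - 1) = 4 * (p e * (1 - p e)) * pivCross edge p X B e := by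
  rw [infl_eq]
  have hx : ∀ y : E → Bool,
      |(2 * gcross edge X B (update y e true) - 1) - (2 * gcross edge X B (update y e false) - 1)|
        = 2 * (gcross edge X B (update y e true) - gcross edge X B (update y e false)) := by
    intro y
    have hle := gcross_update_false_le (edge := edge) X B y e
    rw [abs_of_nonneg (by linarith)]
    ring
  simp_rw [hx]
  unfold pivCross
  simp only [Finset.mul_sum]
  exact Finset.sum_congr rfl fun y _ => by ring

variable [Fintype W]

open Classical in
/-- **THE OSSS VARIANCE INEQUALITY FOR A SET-TO-SET CROSSING WITH AN INTERMEDIATE SEED SET** (Duminil-Copin–Raoufi–Tassion, proof of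
Lemma 3.2, product measure; set-source form).  Finite edge-labelled graph with symmetric incidence and unique endpoints, biases in `[0,1]`;
source set `X`, target set `B`, seed set `Z` such that every open path from `X` to `B` meets `Z` (stated as: some seed vertex is joined to both
ends); `R ≥ 0` with `R(e) ≥ P(a ↔ Z) + P(b ↔ Z)` for every edge `e = ab`.  Then with `A = P(X ↔ B)`,
**`A − A² ≤ Σ_e R(e)·p_e(1−p_e)·P(e pivotal for {X ↔ B})`** — OSSS (`osss_cov_strategy`) for the exploration of the clusters of `Z`
(`SeedExploration.strategy`), which computes `𝟙{X ↔ B}` at halting because the clusters of the seeds are then completely queried, and whose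
revealment of `e = ab` is at most `P(a ↔ Z) + P(b ↔ Z)` (`seedConn_of_query`).
[cite: DuminilCopinRaoufiTassion2019, §3 Lemma 3.2 and its proof (OSSS for the tree exploring the clusters of ∂Λ_k)]
[cite: OdonnellEtAl2005, Thm 3.1 (the two-function OSSS inequality)] -/
theorem variance_le_sum_revealment_mul_pivCross (hsymm : ∀ a b, edge a b = edge b a)
    (hends : ∀ e a b a' b', edge a b = some e → edge a' b' = some e → a' = a ∨ a' = b)
    (p : E → ℝ) (h0 : ∀ e, 0 ≤ p e) (h1 : ∀ e, p e ≤ 1) {Z X B : Set W}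
    (hsep : ∀ (y : E → Bool) (a b : W), a ∈ X → b ∈ B → YReach edge y a b →
      ∃ u ∈ Z, YReach edge y u a ∧ YReach edge y u b)
    {R : E → ℝ} (hR0 : ∀ e, 0 ≤ R e)
    (hR : ∀ e a b, edge a b = some e → seedProb edge p Z a + seedProb edge p Z b ≤ R e) :
    (∑ y, wt p y * gcross edge X B y) - (∑ y, wt p y * gcross edge X B y) ^ 2
      ≤ ∑ e, R e * (p e * (1 - p e)) * pivCross edge p X B e := by
  -- the leaf labels: `+1` iff some seed vertex is joined by queried-open edges to a source and to a target vertex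
  set Lab : (E → Option Bool) → ℝ := fun σ =>
    if ∃ u ∈ Z, (∃ a ∈ X, SReach edge σ u a) ∧ ∃ b ∈ B, SReach edge σ u b then 1 else -1 with hLab
  set g : (E → Bool) → ℝ := fun y => 2 * gcross edge X B y - 1 with hg
  -- halting correctness
  have hL : ∀ σ x, Consistent σ x → strategy edge Z σ = none → Lab σ = g x := by
    intro σ x hc hh
    unfold SeedExploration.strategy at hh
    split_ifs at hh with h
    simp only [not_exists, not_and] at h
    have h'' : ∀ e, σ e = none → ∀ a b, edge a b = some e → ¬Active edge Z σ a := fun e he a b hab => h e he a b hab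
    have key : (∃ u ∈ Z, (∃ a ∈ X, SReach edge σ u a) ∧ ∃ b ∈ B, SReach edge σ u b) ↔ SConn edge X B x := by
      constructor
      · rintro ⟨u, _, ⟨a, ha, hua⟩, b, hb, hub⟩
        refine ⟨a, ha, b, hb, ?_⟩
        have h1 : YReach edge x a u := yReach_symm hsymm (yReach_of_sReach hc hua)
        have h2 : YReach edge x u b := yReach_of_sReach hc hub
        unfold YReach at h1 h2 ⊢
        exact h1.trans h2
      · rintro ⟨a, ha, b, hb, hab⟩
        obtain ⟨u, hu, hua, hub⟩ := hsep x a b ha hb hab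
        exact ⟨u, hu, ⟨a, ha, sReach_of_yReach_of_noPending hc h'' hu hua⟩, b, hb,
          sReach_of_yReach_of_noPending hc h'' hu hub⟩
    simp only [hLab, hg, gcross]
    by_cases hA : ∃ u ∈ Z, (∃ a ∈ X, SReach edge σ u a) ∧ ∃ b ∈ B, SReach edge σ u b
    · rw [if_pos hA, if_pos (key.mp hA)]; norm_num
    · rw [if_neg hA, if_neg (fun hG => hA (key.mpr hG))]; norm_num
  -- OSSS for the seed-exploration strategy, with `g = G = 2·𝟙 − 1`
  have osss := osss_cov_strategy p h0 h1 (strategy_legal edge Z) Lab (g := g)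
    (fun y => abs_two_mul_gcross_sub_one_le X B y) hL g
  -- left side = 4 (A − A²)
  have hsq : ∀ y, gcross edge X B y * gcross edge X B y = gcross edge X B y := by
    intro y; rcases gcross_mem edge X B y with h | h <;> simp [h]
  have hlhs : (∑ y, wt p y * (g y * g y)) - (∑ y, wt p y * g y) * (∑ y, wt p y * g y)
      = 4 * ((∑ y, wt p y * gcross edge X B y) - (∑ y, wt p y * gcross edge X B y) ^ 2) := by
    simp only [hg]
    rw [cov_two_mul_sub_one p (gcross edge X B) (gcross edge X B)]
    simp only [hsq]
    ring
  rw [hlhs] at osss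
  -- revealment of an edge coordinate is at most `R e`
  have hrev : ∀ e, revealment p (strategy edge Z) Lab e ≤ R e := by
    intro e
    by_cases hex : ∃ a b, edge a b = some e
    · obtain ⟨a₀, b₀, hab⟩ := hex
      have h := revealment_le h0 h1 (strategy edge Z) Lab e
        (fun x => SeedConn edge Z x a₀ ∨ SeedConn edge Z x b₀) (fun σ x hc hq => by
          obtain ⟨a, b, hab', hg'⟩ := seedConn_of_query hc hq
          rcases hends e a₀ b₀ a b hab hab' with rfl | rfl
          · exact Or.inl hg'
          · exact Or.inr hg')
      refine h.trans (le_trans ?_ (hR e a₀ b₀ hab))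
      unfold seedProb
      rw [← Finset.sum_add_distrib]
      refine Finset.sum_le_sum fun x _ => ?_
      rw [← mul_add]
      refine mul_le_mul_of_nonneg_left ?_ (wt_nonneg h0 h1 x)
      by_cases ha : SeedConn edge Z x a₀ <;> by_cases hb : SeedConn edge Z x b₀ <;> simp [ha, hb]
    · push Not at hex
      have h := revealment_le h0 h1 (strategy edge Z) Lab e (fun _ => False) (fun σ x hc hq => by
        obtain ⟨a, b, hab, _⟩ := seedConn_of_query hc hq
        exact hex a b hab)
      have h' : revealment p (strategy edge Z) Lab e ≤ 0 := by simpa using h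
      exact h'.trans (hR0 e)
  -- right side
  have hrhs : ∑ e, revealment p (strategy edge Z) Lab e * infl p e g
      ≤ ∑ e, R e * (4 * (p e * (1 - p e)) * pivCross edge p X B e) := by
    refine Finset.sum_le_sum fun e _ => ?_
    rw [show infl p e g = 4 * (p e * (1 - p e)) * pivCross edge p X B e from infl_two_mul_gcross_sub_one p X B e]
    exact mul_le_mul_of_nonneg_right (hrev e)
      (by rw [← infl_two_mul_gcross_sub_one p X B e]; exact infl_nonneg h0 h1 _ _)
  have hfin := osss.trans hrhs
  have hsum : ∑ e, R e * (4 * (p e * (1 - p e)) * pivCross edge p X B e)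
      = 4 * ∑ e, R e * (p e * (1 - p e)) * pivCross edge p X B e := by
    rw [Finset.mul_sum]; exact Finset.sum_congr rfl fun e _ => by ring
  rw [hsum] at hfin
  linarith

end Abstract

/-! ## §2 The annulus crossing: intermediate spheres as seed sets -/

variable {d : ℕ}

/-- **THE SPHERES SEPARATE** (`n ≤ k ≤ N`): every open cube path of `Λ(N)` from the sphere `∂Λ_n` to the sphere `∂Λ_N` passes through
`∂Λ_k`, in the form "a vertex of `∂Λ_k` is joined to both ends" (the sup norm moves by at most one per lattice step:
`CrossingRevealment.exists_sphere_yReach`). [cite: DuminilCopinRaoufiTassion2019, §3 proof of Lemma 3.2 (T determines the event for each k)]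
[cite: DewanMuirhead2022, §2 proof of Lemma 2.9 (any crossing intersects the seed hyperplane)] -/
theorem sphere_separates_spheres {n k N : ℕ} (hnk : n ≤ k) (hkN : k ≤ N) (y : PairIdx d N → Bool) (a b : BoxV d N)
    (ha : a ∈ sphereSeed d N n) (hb : b ∈ sphereSeed d N N) (hab : YReach (latEdge d N) y a b) :
    ∃ u ∈ sphereSeed d N k, YReach (latEdge d N) y u a ∧ YReach (latEdge d N) y u b := by
  change boxNorm a.1 = n at ha
  change boxNorm b.1 = N at hb
  obtain ⟨u, hu, hub⟩ := exists_sphere_yReach (L := k) (by rw [ha]; exact hnk) (by rw [hb]; exact hkN) hab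
  -- the head of the path up to `u`: rerun the induction to get `a ↔ u` as well
  have key : ∀ w : BoxV d N, YReach (latEdge d N) y a w →
      boxNorm w.1 < k ∨ ∃ v : BoxV d N, boxNorm v.1 = k ∧ YReach (latEdge d N) y a v ∧ YReach (latEdge d N) y v w := by
    intro w hw
    unfold YReach at hw
    induction hw with
    | refl =>
      by_cases hlt : boxNorm a.1 < k
      · exact Or.inl hlt
      · exact Or.inr ⟨a, by omega, Relation.ReflTransGen.refl, Relation.ReflTransGen.refl⟩
    | @tail v w hv hvw ih =>
      rcases ih with hlt | ⟨x, hx, hax, hxv⟩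
      · obtain ⟨_, hadj, _⟩ := yAdj_latEdge_iff.1 hvw
        have hstep := boxNorm_le_succ_of_adj hadj
        by_cases hwk : boxNorm w.1 < k
        · exact Or.inl hwk
        · exact Or.inr ⟨w, by omega, Relation.ReflTransGen.tail hv hvw, Relation.ReflTransGen.refl⟩
      · exact Or.inr ⟨x, hx, hax, Relation.ReflTransGen.tail hxv hvw⟩
  rcases key b hab with hlt | ⟨v, hv, hav, hvb⟩
  · omega
  · exact ⟨v, hv, yReach_symm (latEdge_symm N) hav, hvb⟩

/-- For an antitone `f ≥ 0`, every `s`, and `n ≤ N`: `Σ_{k=n+1}^{N} f(|k − s|) ≤ 2·Σ_{j<N−n} f(j)` (the distances `|k − s|`, `n < k ≤ N`, take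
each value `< N − n` at most twice, and larger values are dominated termwise). [cite: DuminilCopinRaoufiTassion2019, §3 proof of Lemma 3.2 (Σ_k μ[u ↔ ∂Λ_{|k−d(u,0)|}(u)] ≤ 2S_n)] -/
theorem sum_Icc_dist_le_shift (f : ℕ → ℝ) (hf : Antitone f) (hf0 : ∀ j, 0 ≤ f j) (s : ℕ) {n N : ℕ} (hnN : n ≤ N) :
    ∑ k ∈ Finset.Icc (n + 1) N, f (Nat.dist k s) ≤ 2 * ∑ j ∈ Finset.range (N - n), f j := by
  -- reindex `k = n + k'`, `k' ∈ Icc 1 (N - n)`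
  have hre : ∑ k ∈ Finset.Icc (n + 1) N, f (Nat.dist k s) = ∑ k' ∈ Finset.Icc 1 (N - n), f (Nat.dist (n + k') s) := by
    have himg : Finset.Icc (n + 1) N = (Finset.Icc 1 (N - n)).image (fun k' => n + k') := by
      ext k
      simp only [Finset.mem_Icc, Finset.mem_image]
      constructor
      · intro hk; exact ⟨k - n, by omega, by omega⟩
      · rintro ⟨k', hk', rfl⟩; omega
    rw [himg, Finset.sum_image (fun a _ b _ h => by simpa using h)]
  rw [hre]
  have hS0 : 0 ≤ ∑ j ∈ Finset.range (N - n), f j := Finset.sum_nonneg fun j _ => hf0 j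
  by_cases hs : s ≤ n
  · -- all distances are `n + k' - s ≥ k'`, so `f(dist) ≤ f(k' - 1)`
    calc ∑ k' ∈ Finset.Icc 1 (N - n), f (Nat.dist (n + k') s)
        ≤ ∑ k' ∈ Finset.Icc 1 (N - n), f (k' - 1) := by
          refine Finset.sum_le_sum fun k' hk' => hf ?_
          rw [Finset.mem_Icc] at hk'
          rw [Nat.dist_eq_sub_of_le_right (by omega)]; omega
      _ = ∑ j ∈ Finset.range (N - n), f j := by
          have himg : Finset.Icc 1 (N - n) = (Finset.range (N - n)).image (fun j => j + 1) := by
            ext k; simp only [Finset.mem_Icc, Finset.mem_range, Finset.mem_image]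
            constructor
            · intro hk; exact ⟨k - 1, by omega, by omega⟩
            · rintro ⟨j, hj, rfl⟩; omega
          rw [himg, Finset.sum_image (fun a _ b _ h => by simpa using h)]
          exact Finset.sum_congr rfl fun j _ => by simp
      _ ≤ 2 * ∑ j ∈ Finset.range (N - n), f j := by linarith
  · push Not at hs
    -- `s = n + t` with `t ≥ 1`; distances are `dist k' t`
    obtain ⟨t, rfl⟩ : ∃ t, s = n + t := ⟨s - n, by omega⟩
    have hdist : ∀ k', Nat.dist (n + k') (n + t) = Nat.dist k' t := fun k' => Nat.dist_add_add_left n k' t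
    simp only [hdist]
    by_cases ht : t ≤ N - n
    · exact sum_Icc_dist_le f hf hf0 ht
    · push Not at ht
      -- `t > N - n ≥ k'`: `dist k' t = t - k' ≥ (N - n) - k'`... dominate by the reflected sum
      calc ∑ k' ∈ Finset.Icc 1 (N - n), f (Nat.dist k' t)
          ≤ ∑ k' ∈ Finset.Icc 1 (N - n), f (Nat.dist k' (N - n)) := by
            refine Finset.sum_le_sum fun k' hk' => hf ?_
            rw [Finset.mem_Icc] at hk'
            rw [Nat.dist_eq_sub_of_le (by omega : k' ≤ t), Nat.dist_eq_sub_of_le hk'.2]; omega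
        _ ≤ 2 * ∑ j ∈ Finset.range (N - n), f j := sum_Icc_dist_le f hf hf0 le_rfl

/-- ONE SPHERE: for `n ≤ k ≤ N` (`d ≥ 1`), with `u = P_p(boxCrossing d n N)`,
`u − u² ≤ Σ_e (θ_{|k−‖a_e‖|} + θ_{|k−‖b_e‖|})·b_e(1−b_e)·Piv_e` on the box cube of `Λ(N)` (biases `b_e = p` on lattice edges, `0` elsewhere;
`Piv_e` the cube pivotality for `{∂Λ_n ↔ ∂Λ_N}`). [cite: DuminilCopinRaoufiTassion2019, §3 Lemma 3.2 (OSSS for the tree of ∂Λ_k)] -/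
theorem annulusCrossing_variance_le_sphere (hd : 1 ≤ d) {n k N : ℕ} (hnk : n ≤ k) (hkN : k ≤ N) (p : unitInterval) :
    (bondPercolation (zdGraph d) p).real (boxCrossing d n N) - ((bondPercolation (zdGraph d) p).real (boxCrossing d n N)) ^ 2
      ≤ ∑ e : PairIdx d N, revMaj N p k e * (boxBias d N p e * (1 - boxBias d N p e))
          * pivCross (latEdge d N) (boxBias d N p) (sphereSeed d N n) (sphereSeed d N N) e := by
  classical
  have h := variance_le_sum_revealment_mul_pivCross (edge := latEdge d N) (latEdge_symm N) (latEdge_ends N)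
    (boxBias d N p) (boxBias_nonneg N p.2.1) (boxBias_le_one N p.2.2)
    (Z := sphereSeed d N k) (X := sphereSeed d N n) (B := sphereSeed d N N)
    (fun y a b ha hb hab => sphere_separates_spheres hnk hkN y a b ha hb hab)
    (R := revMaj N p k) (revMaj_nonneg N p k) (fun e a b hab => by
      obtain ⟨_, he⟩ := latEdge_eq_some_iff.1 hab
      unfold revMaj
      rw [he, Sym2.lift_mk]
      exact add_le_add (seedProb_sphereSeed_le hd N p k a) (seedProb_sphereSeed_le hd N p k b))
  rwa [sum_wt_gcross_eq hd (hnk.trans hkN) p] at h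

/-- **THE OSSS VARIANCE INEQUALITY FOR THE ANNULUS CROSSING** (sum form; every `d ≥ 1`, `n ≤ N`, `p ∈ [0,1]`):
`(N − n)·u(1 − u) ≤ 4·S_{N−n}(p)·p(1−p)·Σ_{z ⊆ Λ(N)} P_p(z ∈ E(ℤ^d), z pivotal for boxCrossing d n N)`, `u = P_p(boxCrossing d n N)`,
`S_m(p) = Σ_{j<m} π_p(j)` — the one-sphere inequalities summed over the `N − n` intermediate spheres `∂Λ_k`, `n < k ≤ N`, each pair
`{a,b} ⊆ Λ(N)` being revealed by the `k`-th tree with probability `≤ θ_{|k−‖a‖|} + θ_{|k−‖b‖|}`, whose sum over `k` is `≤ 4 S_{N−n}`.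
[cite: DuminilCopinRaoufiTassion2019, §3 Lemma 3.2 and eq. (3.2) (Σ_e Cov ≥ n·θ(1−θ)/(8S_n), q = 1)] -/
theorem annulusCrossing_variance_le (hd : 1 ≤ d) {n N : ℕ} (hnN : n ≤ N) (p : unitInterval) :
    ((N - n : ℕ) : ℝ) * ((bondPercolation (zdGraph d) p).real (boxCrossing d n N)
        * (1 - (bondPercolation (zdGraph d) p).real (boxCrossing d n N)))
      ≤ 4 * (∑ j ∈ Finset.range (N - n), oneArmProb d p j) * ((p : ℝ) * (1 - p))
          * ∑ z ∈ (box d N).sym2, (bondPercolation (zdGraph d) p).real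
              {ω | z ∈ (zdGraph d).edgeSet ∧ IsPivotal (boxCrossing d n N) z ω} := by
  classical
  set u : ℝ := (bondPercolation (zdGraph d) p).real (boxCrossing d n N) with hu
  set S : ℝ := ∑ j ∈ Finset.range (N - n), oneArmProb d p j with hS
  set c : PairIdx d N → ℝ := fun e => boxBias d N p e * (1 - boxBias d N p e)
    * pivCross (latEdge d N) (boxBias d N p) (sphereSeed d N n) (sphereSeed d N N) e with hc
  have hc0 : ∀ e, 0 ≤ c e := fun e =>
    mul_nonneg (mul_nonneg (boxBias_nonneg N p.2.1 e) (by linarith [boxBias_le_one N p.2.2 e]))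
      (pivCross_nonneg (boxBias_nonneg N p.2.1) (boxBias_le_one N p.2.2) _ _ e)
  -- sum the one-sphere inequalities over `k = n+1, …, N`
  have hsum : ∑ k ∈ Finset.Icc (n + 1) N, (u - u ^ 2) ≤ ∑ k ∈ Finset.Icc (n + 1) N, ∑ e, revMaj N p k e * c e := by
    refine Finset.sum_le_sum fun k hk => ?_
    rw [Finset.mem_Icc] at hk
    have := annulusCrossing_variance_le_sphere hd (show n ≤ k by omega) hk.2 p
    simpa only [hc, mul_assoc] using this
  rw [Finset.sum_const, Nat.card_Icc, nsmul_eq_mul, Finset.sum_comm] at hsum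
  have hcard : ((N + 1 - (n + 1) : ℕ) : ℝ) = ((N - n : ℕ) : ℝ) := by congr 1; omega
  rw [hcard] at hsum
  -- bound the summed revealment by `4 S`
  have hrev : ∑ e, ∑ k ∈ Finset.Icc (n + 1) N, revMaj N p k e * c e ≤ ∑ e, 4 * S * c e := by
    refine Finset.sum_le_sum fun e _ => ?_
    rw [← Finset.sum_mul]
    refine mul_le_mul_of_nonneg_right ?_ (hc0 e)
    obtain ⟨z, hz⟩ := e
    unfold revMaj
    induction z using Sym2.ind with
    | h a b =>
      simp only [Sym2.lift_mk]
      rw [Finset.sum_add_distrib]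
      have hA := sum_Icc_dist_le_shift _ (antitone_real_siteToBoundary (d := d) p) (fun _ => measureReal_nonneg)
        (boxNorm a) hnN
      have hB := sum_Icc_dist_le_shift _ (antitone_real_siteToBoundary (d := d) p) (fun _ => measureReal_nonneg)
        (boxNorm b) hnN
      change ∑ k ∈ Finset.Icc (n + 1) N, (bondPercolation (zdGraph d) p).real (siteToBoundary d (Nat.dist k (boxNorm a)))
          + ∑ k ∈ Finset.Icc (n + 1) N, (bondPercolation (zdGraph d) p).real (siteToBoundary d (Nat.dist k (boxNorm b)))
        ≤ 4 * ∑ j ∈ Finset.range (N - n), oneArmProb d p j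
      simp only [oneArmProb]
      linarith
  -- identify `Σ_e c_e` with `p(1−p)` times Russo's sum
  have hcs : ∑ e, 4 * S * c e = 4 * S * ((p : ℝ) * (1 - p))
      * ∑ z ∈ (box d N).sym2, (bondPercolation (zdGraph d) p).real
          {ω | z ∈ (zdGraph d).edgeSet ∧ IsPivotal (boxCrossing d n N) z ω} := by
    rw [← Finset.mul_sum]
    simp only [hc, bias_mul_pivCross_eq hd hnN]
    rw [← Finset.mul_sum, ← Finset.sum_coe_sort (box d N).sym2]
    ring
  have hfin := hsum.trans (hrev.trans (le_of_eq hcs))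
  have : ((N - n : ℕ) : ℝ) * (u * (1 - u)) = ((N - n : ℕ) : ℝ) * (u - u ^ 2) := by ring
  rw [this]
  exact hfin

/-! ## §3 With Russo's formula: the differential inequality -/

/-- **THE OSSS DIFFERENTIAL INEQUALITY FOR THE ANNULUS CROSSING** (every `d ≥ 1`, `n ≤ N`, `0 < p < 1`): `q ↦ u_q(n,N) = P_q(boxCrossing d n N)`
has at `p` the derivative `D = Σ_{z ⊆ Λ(N)} P_p(z ∈ E(ℤ^d), z pivotal) = E_p[N_piv] ≥ 0` (Russo), and
**`(N − n)·u_p(1 − u_p) ≤ 4p(1−p)·S_{N−n}(p)·D`**, `S_m(p) = Σ_{j<m} π_p(j)` — NO band condition (compare gen 18's Talagrand–Russo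
`exists_hasDerivAt_boxCrossing_ge`: `D ≥ (Λ/16)u(1−u)` only where `2π_p(m) ≤ e^{−Λ}` AND `e^{−Λ/4} ≤ u(1−u)`).
[cite: DuminilCopinRaoufiTassion2019, §3 proof of Thm 1.2 eqs. (3.2)–(3.4) (θ_n' ≥ c·(n/S_n)·θ_n(1−θ_n))] [cite: RussoZW1981, §4 Lemma 3] -/
theorem exists_hasDerivAt_real_boxCrossing_ge_osss (hd : 1 ≤ d) {n N : ℕ} (hnN : n ≤ N) {p : ℝ} (hp : p ∈ Set.Ioo (0 : ℝ) 1) :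
    ∃ D : ℝ, HasDerivAt (fun q : ℝ => (bondPercolation (zdGraph d) (Set.projIcc 0 1 zero_le_one q)).real
        (boxCrossing d n N)) D p ∧ 0 ≤ D ∧
      ((N - n : ℕ) : ℝ) * ((bondPercolation (zdGraph d) (Set.projIcc 0 1 zero_le_one p)).real (boxCrossing d n N)
          * (1 - (bondPercolation (zdGraph d) (Set.projIcc 0 1 zero_le_one p)).real (boxCrossing d n N)))
        ≤ 4 * (p * (1 - p)) * (∑ j ∈ Finset.range (N - n), oneArmProb d (Set.projIcc 0 1 zero_le_one p) j) * D := by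
  classical
  have hpI : p ∈ Set.Icc (0 : ℝ) 1 := ⟨hp.1.le, hp.2.le⟩
  have hproj : Set.projIcc 0 1 zero_le_one p = ⟨p, hpI⟩ := Set.projIcc_of_mem _ hpI
  have hA : IsUpperSet (boxCrossing d n N) := by rw [boxCrossing_eq_linked]; exact isUpperSet_linked _ _ _
  have hF : DeterminedBy (boxCrossing d n N) (↑((box d N).sym2) : Set (Sym2 (Site d))) := by
    have h1 : DeterminedBy (boxCrossing d n N) (↑(edgesIn (zdGraph d) (box d N)) : Set (Sym2 (Site d))) := by
      rw [boxCrossing_eq_linked]; exact determinedBy_linked_edgesIn _ _ _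
    refine h1.mono fun e he => ?_
    exact Finset.mem_coe.2 (Finset.mem_filter.1 (Finset.mem_coe.1 he)).2
  refine ⟨_, russo_formula_sum_holds (zdGraph d) hA ((box d N).sym2) hF p hp,
    Finset.sum_nonneg fun _ _ => measureReal_nonneg, ?_⟩
  rw [hproj]
  have h := annulusCrossing_variance_le hd hnN ⟨p, hpI⟩
  calc ((N - n : ℕ) : ℝ) * ((bondPercolation (zdGraph d) ⟨p, hpI⟩).real (boxCrossing d n N)
        * (1 - (bondPercolation (zdGraph d) ⟨p, hpI⟩).real (boxCrossing d n N)))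
      ≤ 4 * (∑ j ∈ Finset.range (N - n), oneArmProb d ⟨p, hpI⟩ j) * ((p : ℝ) * (1 - p))
          * ∑ z ∈ (box d N).sym2, (bondPercolation (zdGraph d) ⟨p, hpI⟩).real
              {ω | z ∈ (zdGraph d).edgeSet ∧ IsPivotal (boxCrossing d n N) z ω} := h
    _ = _ := by ring

/-- **THE OSSS DIFFERENTIAL INEQUALITY FOR THE ANNULUS CROSSING, short form** (every `d ≥ 1`, `n ≤ N`, `0 < p < 1`):
**`(N − n)·u_p(1 − u_p) ≤ S_{N−n}(p)·E_p[N_piv(boxCrossing d n N)]`** (`4p(1−p) ≤ 1`).  At aspect 2, `N = 2n`: the expected number of pivotal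
edges of the annulus crossing is at least `n·u(1−u)/S_n(p)`, `S_n(p)/n` the Cesàro mean of the one-arm probabilities below scale `n`.
[cite: DuminilCopinRaoufiTassion2019, §3 proof of Thm 1.2 eq. (3.4) (θ_n' ≥ c·(n/S_n)·θ_n(1−θ_n); the constant 4p(1−p) ≤ 1)] -/
theorem exists_hasDerivAt_real_boxCrossing_ge_osss' (hd : 1 ≤ d) {n N : ℕ} (hnN : n ≤ N) {p : ℝ} (hp : p ∈ Set.Ioo (0 : ℝ) 1) :
    ∃ D : ℝ, HasDerivAt (fun q : ℝ => (bondPercolation (zdGraph d) (Set.projIcc 0 1 zero_le_one q)).real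
        (boxCrossing d n N)) D p ∧ 0 ≤ D ∧
      ((N - n : ℕ) : ℝ) * ((bondPercolation (zdGraph d) (Set.projIcc 0 1 zero_le_one p)).real (boxCrossing d n N)
          * (1 - (bondPercolation (zdGraph d) (Set.projIcc 0 1 zero_le_one p)).real (boxCrossing d n N)))
        ≤ (∑ j ∈ Finset.range (N - n), oneArmProb d (Set.projIcc 0 1 zero_le_one p) j) * D := by
  obtain ⟨D, hD, hD0, h⟩ := exists_hasDerivAt_real_boxCrossing_ge_osss hd hnN hp
  refine ⟨D, hD, hD0, h.trans ?_⟩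
  have hS0 : 0 ≤ ∑ j ∈ Finset.range (N - n), oneArmProb d (Set.projIcc 0 1 zero_le_one p) j :=
    Finset.sum_nonneg fun _ _ => measureReal_nonneg
  have h4 : 4 * (p * (1 - p)) ≤ 1 := by nlinarith [sq_nonneg (2 * p - 1)]
  nlinarith [mul_nonneg hS0 hD0]

end Summit.CriticalPhenomena.PercolationContinuityZ3.Theorems.Crossing

end
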